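import Summits.Ventures.PercRepro.GenQRule
import Summits.Ventures.PercRepro.SixFourFrame
import Summits.Ventures.PercRepro.SixFourT1
import Summits.Ventures.PercRepro.SixFourResidueClausesThree
import Summits.Ventures.PercRepro.SixFourResidueTypeThreeSmallHolds

/-!
# PercRepro — C-025 at `(q + 2, q)`: THE THIRD WITNESS AT THE TOP TYPE — the row needs only the balances of the
types `t ≤ q − 1`; at `(6, 4)`: `RLS M 6 4 ⇐ TwentyOnePrime` alone (night-4, gen 0)

The per-flat transfer (`perFlat_of_Jq_nonneg`, p3's `perSolid_of_J_nonneg` at `q = 4`) bounds the supply of a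
rank-`q` flat `G` of type `t` by `(q + 2 − t) · Σ w_∞` through `q + 2 − t = ρ(E ∖ G) ≤ |E ∖ G|` — the SINGLE-POINT
witnesses `B ∪ {x}` over ALL `x ∈ E ∖ G` are already summed (`supply_single_ge_q`), only their number was
under-counted.  At the TOP TYPE `t = q` (`ρ(E ∖ G) = 2`) of a COLOOP-FREE matroid of rank `q + 2` the set `E ∖ G`
has at least THREE points (`three_le_card_sdiff_of_top`: two points of rank `2` off a rank-`q` flat of a rank-`(q + 2)`
matroid are coloops), so the supply is `≥ 3 · Σ w_∞` — the supply of type `q − 1` — while the demand at type `q`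
is at most the demand at type `q − 1` (`U_q ⊆ U_{q−1}`).  Hence the type-`q` flats are covered by the TYPE-`(q − 1)`
BALANCE (`perFlat_of_Jq_nonneg'`), and

* **`rls_succ_succ_of_perFlatBelow`**: the core of the `(q + 2, q)` row follows from the balances at the types
  `t ≤ q − 1` alone (`PerFlatBelow q`);
* **`rls_six_four_of_J_three`** / **`rls_six_four_of_twentyOnePrime`**: at `(6, 4)` the types `t ≤ 2` are landed
  (`SixFourT1`), so C-025 at `(6, 4)` on EVERY finite matroid follows from `0 ≤ J₃(G)` on every solid — i.e. from
  `TypeThreeSmall` (landed) and `TwentyOnePrime` (Theorem 21′) — with NO type-`4` piece: Theorem 22 / 22′,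
  `PlaneAddTwoFour`, `PlaneLineFourBig`, Theorem G and the `g ≤ 9` clause at `t = 4` are not needed for the row.
  (They remain true and landed; the row's logical dependency is what shrinks.)

mine-2's Lemma R (§19.1) restricts to `G ∪ W` with `W` a basis of `E ∖ G` — at the top type two points, both
coloops of the restriction — and so loses exactly this witness; the paper's §21–22 closed the harder two-witness
balance.  Imports the landed `(6, 4)` frame and pieces; axioms standard.
-/

open scoped Matroid

namespace PercRepro.GenQ

open Finset ThmH PerFlat ThmN SixFour

variable {α : Type*} [DecidableEq α] {M : Matroid α} [M.Finite]

/-! ## The third witness at the top type -/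

/-- **Three points off a top-type flat**: in a coloop-free matroid of rank `q + 2`, a rank-`q` flat `G` with
`ρ(E ∖ G) = 2` has `|E ∖ G| ≥ 3` (a two-point complement of rank `2` would consist of coloops). -/
theorem three_le_card_sdiff_of_top {G : Finset α} {q : ℕ} (hcol : ∀ e, ¬ M.IsColoop e)
    (hR : M.eRank = ((q + 2 : ℕ) : ℕ∞)) (hG : G ∈ flatsQ M q)
    (ht : M.eRk ((gr M \ G : Finset α) : Set α) = 2) : 3 ≤ (gr M \ G).card := by
  by_contra hlt
  push Not at hlt
  have hle : 2 ≤ (gr M \ G).card := by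
    have h := M.eRk_le_encard ((gr M \ G : Finset α) : Set α)
    rw [ht, Set.encard_coe_eq_coe_finsetCard] at h
    exact_mod_cast h
  have hcard : (gr M \ G).card = 2 := by omega
  obtain ⟨x, hx⟩ := Finset.card_pos.1 (by omega : 0 < (gr M \ G).card)
  have hxE : x ∈ M.E := by
    rw [← coe_gr M]
    exact_mod_cast (Finset.mem_sdiff.1 hx).1
  apply hcol x
  rw [Matroid.isColoop_iff_notMem_closure_compl hxE]
  intro hxcl
  -- `ρ(E ∖ {x}) = ρ(E)`
  have h1 : M.eRk (M.E \ {x}) = M.eRank := by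
    rw [← M.eRk_closure_eq, ← Matroid.closure_insert_eq_of_mem_closure hxcl, Set.insert_sdiff_singleton,
      Set.insert_eq_of_mem hxE, M.eRk_closure_eq, M.eRk_ground]
  -- but `E ∖ {x} ⊆ G ∪ ((E ∖ G) ∖ {x})` has rank `≤ q + 1`
  have hsub : M.E \ {x} ⊆ (G : Set α) ∪ (((gr M \ G).erase x : Finset α) : Set α) := by
    intro y hy
    rw [Set.mem_sdiff, Set.mem_singleton_iff] at hy
    rw [Set.mem_union, Finset.mem_coe, Finset.mem_coe, Finset.mem_erase, Finset.mem_sdiff]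
    by_cases hyG : y ∈ G
    · exact Or.inl hyG
    · right
      refine ⟨hy.2, ?_, hyG⟩
      rw [← coe_gr M] at hy
      exact_mod_cast hy.1
  have h2 : M.eRk (M.E \ {x}) ≤ M.eRk (G : Set α) + M.eRk (((gr M \ G).erase x : Finset α) : Set α) :=
    (M.eRk_mono hsub).trans (M.eRk_union_le_eRk_add_eRk _ _)
  have h3 : M.eRk (((gr M \ G).erase x : Finset α) : Set α) ≤ 1 := by
    have h := M.eRk_le_encard (((gr M \ G).erase x : Finset α) : Set α)
    rw [Set.encard_coe_eq_coe_finsetCard, Finset.card_erase_of_mem hx, hcard] at h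
    exact h
  rw [h1, hR, (mem_flatsQ.1 hG).2.2] at h2
  have h4 : ((q + 2 : ℕ) : ℕ∞) ≤ ((q + 1 : ℕ) : ℕ∞) := by
    calc ((q + 2 : ℕ) : ℕ∞) ≤ (q : ℕ∞) + M.eRk (((gr M \ G).erase x : Finset α) : Set α) := h2
      _ ≤ (q : ℕ∞) + 1 := by gcongr
      _ = ((q + 1 : ℕ) : ℕ∞) := by push_cast; rfl
  have := (Nat.cast_le (α := ℕ∞)).1 h4
  omega

/-! ## The transfer with a lower type -/

/-- **The per-flat inequality from a balance of a LOWER type**: if `t′ ≤ typeOfQ M q G` and `q + 2 − t′ ≤ |E ∖ G|`,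
then `0 ≤ Jq M G q t′` gives the per-flat inequality of `PerFlat.c025_of_perFlat_normalized` at `(q + 2, q)`. -/
theorem perFlat_of_Jq_nonneg' {G : Finset α} {q t' : ℕ} (hG : G ∈ flatsQ M q) (ht' : t' ≤ typeOfQ M q G)
    (hW : q + 2 - t' ≤ (gr M \ G).card) (hJ : 0 ≤ Jq M G q t') :
    (((q : ℚ) + 2) / ((q : ℚ) + 1)) * ((UqG M (q + 2) q G).card : ℚ) ≤
      ∑ S ∈ Yq M (q + 2) q, fHardQ M q G S / ∑ G' ∈ flatsQ M q, fHardQ M q G' S := by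
  have hgoal : (∑ S ∈ Yq M (q + 2) q, fHardQ M q G S / ∑ G' ∈ flatsQ M q, fHardQ M q G' S) =
      ∑ S ∈ Yq M (q + 2) q, fHardQ M q G S / DHardQ M q S := rfl
  rw [hgoal]
  have hsupply := supply_single_ge_q hG
  -- demand: `DF_{t'} ⊆ DF_{typeOfQ}`, so `#U_G + DF_{t'} ≤ N_q`
  have hdemand : (UqG M (q + 2) q G).card + DFq M G q t' ≤ Nq M G q := by
    have h := card_UqG_add_DFq_le (M := M) q G
    have hmono : DFq M G q t' ≤ DFq M G q (typeOfQ M q G) := by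
      unfold DFq
      apply Finset.card_le_card
      intro B hB
      rw [Finset.mem_filter] at hB ⊢
      exact ⟨hB.1, hB.2.trans (by exact_mod_cast ht')⟩
    omega
  have hsum : 0 ≤ ∑ B ∈ Rq M G q, wInf M B := Finset.sum_nonneg (fun B _ => (wInf_pos B).le)
  have hJ' : (((q : ℚ) + 2) / ((q : ℚ) + 1)) * ((Nq M G q : ℚ) - (DFq M G q t' : ℚ)) ≤
      ((q : ℚ) + 2 - (t' : ℚ)) * ∑ B ∈ Rq M G q, wInf M B := by
    unfold Jq at hJ
    rw [← Finset.mul_sum] at hJ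
    linarith
  have ht'q : t' ≤ q + 2 := ht'.trans (typeOfQ_le q G)
  have hW' : (q : ℚ) + 2 - (t' : ℚ) ≤ ((gr M \ G).card : ℚ) := by
    have h := (Nat.cast_le (α := ℚ)).2 hW
    rw [Nat.cast_sub ht'q] at h
    push_cast at h
    linarith
  have hd : ((UqG M (q + 2) q G).card : ℚ) ≤ (Nq M G q : ℚ) - (DFq M G q t' : ℚ) := by
    have h : (((UqG M (q + 2) q G).card + DFq M G q t' : ℕ) : ℚ) ≤ (Nq M G q : ℚ) := by
      exact_mod_cast hdemand
    rw [Nat.cast_add] at h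
    linarith
  have hΦ : (0 : ℚ) ≤ ((q : ℚ) + 2) / ((q : ℚ) + 1) := by positivity
  calc (((q : ℚ) + 2) / ((q : ℚ) + 1)) * ((UqG M (q + 2) q G).card : ℚ)
      ≤ (((q : ℚ) + 2) / ((q : ℚ) + 1)) * ((Nq M G q : ℚ) - (DFq M G q t' : ℚ)) :=
        mul_le_mul_of_nonneg_left hd hΦ
    _ ≤ ((q : ℚ) + 2 - (t' : ℚ)) * ∑ B ∈ Rq M G q, wInf M B := hJ'
    _ ≤ ((gr M \ G).card : ℚ) * ∑ B ∈ Rq M G q, wInf M B := mul_le_mul_of_nonneg_right hW' hsum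
    _ ≤ ∑ S ∈ Yq M (q + 2) q, fHardQ M q G S / DHardQ M q S := hsupply

/-- A top-type flat forces `ρ(E) = q + 2` and `ρ(E ∖ G) = 2`. -/
theorem eRk_sdiff_eq_two_of_typeOfQ_eq {G : Finset α} {q : ℕ} (hq : 1 ≤ q) (hG : G ∈ flatsQ M q)
    (hge : ((q + 2 : ℕ) : ℕ∞) ≤ M.eRank) (ht : typeOfQ M q G = q) :
    M.eRk ((gr M \ G : Finset α) : Set α) = 2 ∧ M.eRank = ((q + 2 : ℕ) : ℕ∞) := by
  have hGg : G ⊆ gr M := (mem_flatsQ.1 hG).1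
  have hr : M.eRk (G : Set α) = (q : ℕ∞) := (mem_flatsQ.1 hG).2.2
  obtain ⟨r, hr', -⟩ := eRk_eq_nat M (gr M \ G)
  unfold typeOfQ at ht
  rw [hr', ENat.toNat_coe] at ht
  have hE : G ∪ (gr M \ G) = gr M := Finset.union_sdiff_of_subset hGg
  have h := M.eRk_union_le_eRk_add_eRk (G : Set α) ((gr M \ G : Finset α) : Set α)
  rw [← Finset.coe_union, hE, coe_gr, M.eRk_ground, hr, hr'] at h
  have h' := hge.trans h
  have h'' : ((q + 2 : ℕ) : ℕ∞) ≤ ((q + r : ℕ) : ℕ∞) := by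
    push_cast
    exact h'
  have hqr := (Nat.cast_le (α := ℕ∞)).1 h''
  have hr2 : r = 2 := by omega
  refine ⟨by rw [hr', hr2]; rfl, le_antisymm ?_ hge⟩
  rw [hr2] at h
  calc M.eRank ≤ (q : ℕ∞) + ((2 : ℕ) : ℕ∞) := h
    _ = ((q + 2 : ℕ) : ℕ∞) := by push_cast; rfl

/-! ## The core from the balances of the types `t ≤ q − 1` -/

/-- **The per-flat balance at the types `t ≤ q − 1`** on simple matroids. -/
def PerFlatBelow (q : ℕ) : Prop :=
  ∀ {β : Type} [DecidableEq β] (M : Matroid β) [M.Finite] (G : Finset β), Simple M → G ⊆ gr M →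
    M.eRk (G : Set β) = (q : ℕ∞) → ∀ t, t + 1 ≤ q → 0 ≤ Jq M G q t

/-- **The core of the `(q + 2, q)` row from the balances of the types `t ≤ q − 1`**: on a simple matroid of rank
`≥ q + 2`, coloop-free when its rank is `q + 2`, `PerFlatBelow q` gives `RLS M (q + 2) q` — the top-type flats are
covered by the type-`(q − 1)` balance through their third witness. -/
theorem rls_succ_succ_of_perFlatBelow {α : Type} [DecidableEq α] (q : ℕ) (hq : 1 ≤ q) (hbelow : PerFlatBelow q)
    (M : Matroid α) [M.Finite] (hs : Simple M) (hge : ((q + 2 : ℕ) : ℕ∞) ≤ M.eRank)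
    (hcol : M.eRank = ((q + 2 : ℕ) : ℕ∞) → ∀ e, ¬ M.IsColoop e) : RLS M (q + 2) q := by
  unfold RLS
  rw [phiK_succ_succ]
  apply PerFlat.c025_of_perFlat_normalized M (q + 2) q (by positivity) (fHardQ M q)
    (fun P S => fHardQ_nonneg q P S)
  intro G hG
  have hGg : G ⊆ gr M := (mem_flatsQ.1 hG).1
  have hr : M.eRk (G : Set α) = (q : ℕ∞) := (mem_flatsQ.1 hG).2.2
  have htq := typeOfQ_le_q hG hge
  by_cases htop : typeOfQ M q G = q
  · -- the top type: three witnesses, the type-`(q − 1)` balance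
    obtain ⟨h2, hR⟩ := eRk_sdiff_eq_two_of_typeOfQ_eq hq hG hge htop
    have h3 := three_le_card_sdiff_of_top (hcol hR) hR hG h2
    refine perFlat_of_Jq_nonneg' hG (t' := q - 1) (by omega) (by omega) ?_
    exact hbelow M G hs hGg hr (q - 1) (by omega)
  · exact perFlat_of_Jq_nonneg' hG le_rfl (sub_typeOfQ_le_card q G)
      (hbelow M G hs hGg hr _ (by omega))

/-! ## `(6, 4)` from the type-`3` balance alone -/

/-- **C-025 at `(6, 4)` on every finite matroid from `0 ≤ J₃(G)` on every solid**: the types `t ≤ 2` are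
`SixFourT1`, the type `4` is covered by the type-`3` balance through the third witness. -/
theorem rls_six_four_of_J_three {α : Type} [DecidableEq α]
    (h3 : ∀ {β : Type} [DecidableEq β] (M : Matroid β) [M.Finite] (G : Finset β), Simple M → G ⊆ gr M →
      M.eRk (G : Set β) = 4 → 0 ≤ J M G 3)
    (M : Matroid α) [M.Finite] : RLS M 6 4 := by
  apply rls_six_four_of_core
  intro M _ hs hge hcol
  have hbelow : PerFlatBelow 4 := by
    intro β _ M _ G hs' hG hr t ht
    rw [Jq_four]
    have hr' : M.eRk (G : Set β) = 4 := by rw [hr]; rfl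
    rcases (show t = 0 ∨ t = 1 ∨ t = 2 ∨ t = 3 by omega) with rfl | rfl | rfl | rfl
    · exact J_zero_nonneg hs' hG
    · exact J_one_nonneg hs' hG hr'
    · exact J_two_nonneg hs' hG hr'
    · exact h3 M G hs' hG hr'
  have := rls_succ_succ_of_perFlatBelow 4 (by norm_num) hbelow M hs (by exact_mod_cast hge)
    (fun hR => hcol (by exact_mod_cast hR))
  exact this

/-- **C-025 at `(6, 4)` on every finite matroid from the two type-`3` pieces of record**: `TypeThreeSmall`
(`g ≤ 9`, landed) and `TwentyOnePrime` (Theorem 21′, `g ≥ 10`). -/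
theorem rls_six_four_of_typeThree {α : Type} [DecidableEq α] (h3s : TypeThreeSmall) (h3b : TwentyOnePrime)
    (M : Matroid α) [M.Finite] : RLS M 6 4 := by
  apply rls_six_four_of_J_three
  intro β _ M _ G hs hG hr
  by_cases hg : 10 ≤ G.card
  · exact h3b M G hs hG hr hg
  · exact h3s M G hs hG hr (by omega)

/-- **C-025 at `(6, 4)` on every finite matroid from `TwentyOnePrime` alone** (`typeThreeSmall_holds` is in the
tree): no type-`4` piece is needed for the row. -/
theorem rls_six_four_of_twentyOnePrime {α : Type} [DecidableEq α] (h3b : TwentyOnePrime)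
    (M : Matroid α) [M.Finite] : RLS M 6 4 :=
  rls_six_four_of_typeThree typeThreeSmall_holds h3b M

/-- **C-025 at `(6, 4)` in the set-builder spelling of `C025`, from `TwentyOnePrime` alone**:
`Φ(6, 4) · #{A ⊆ E : ρ(A) = 6, ρ(E ∖ A) = 4} ≤ #{A ⊆ E : 4 < ρ(A) < 6}` on every finite matroid. -/
theorem c025_six_four_of_twentyOnePrime {α : Type} [DecidableEq α] (h3b : TwentyOnePrime)
    (M : Matroid α) [M.Finite] :
    phiK 6 4 * ({A : Set α | A ⊆ M.E ∧ M.eRk A = ((6 : ℕ) : ℕ∞) ∧ M.eRk (M.E \ A) = ((4 : ℕ) : ℕ∞)}.ncard : ℚ) ≤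
      ({A : Set α | A ⊆ M.E ∧ ((4 : ℕ) : ℕ∞) < M.eRk A ∧ M.eRk A < ((6 : ℕ) : ℕ∞)}.ncard : ℚ) := by
  have h := rls_six_four_of_twentyOnePrime h3b M
  unfold ThmN.RLS at h
  exact h


/-! ## The residue, re-cut: the family `𝔉` at the types `t ≤ q − 1` -/

/-- **The per-flat residue at `(q + 2, q)`, re-cut by the third witness**: the balance at the types `t ≤ q − 1` on
the family `𝔉` of simple matroids. -/
def PerFlatResidueBelow (q : ℕ) : Prop :=
  ∀ {β : Type} [DecidableEq β] (M : Matroid β) [M.Finite] (G : Finset β), Simple M → G ⊆ gr M →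
    M.eRk (G : Set β) = (q : ℕ∞) → TwoHyp M G q → ∀ t, t + 1 ≤ q → 0 ≤ Jq M G q t

/-- The balances of the types `t ≤ q − 1` reduce to the family `𝔉` (the dichotomy `Jq_nonneg_of_not_twoHyp`
covers its complement at every type). -/
theorem perFlatBelow_of_residueBelow {q : ℕ} (h : PerFlatResidueBelow q) : PerFlatBelow q := by
  intro β _ M _ G hs hG hr t ht
  by_cases hF : TwoHyp M G q
  · exact h M G hs hG hr hF t ht
  · exact Jq_nonneg_of_not_twoHyp hG hr hF (by omega)

/-- **The core of the `(q + 2, q)` row from the re-cut residue**: `PerFlatResidueBelow q` — the balance on `𝔉` at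
the types `t ≤ q − 1` — gives `RLS M (q + 2) q` on every simple matroid of rank `≥ q + 2`, coloop-free at rank
`q + 2`. -/
theorem rls_succ_succ_of_residueBelow {α : Type} [DecidableEq α] (q : ℕ) (hq : 1 ≤ q)
    (hres : PerFlatResidueBelow q) (M : Matroid α) [M.Finite] (hs : Simple M)
    (hge : ((q + 2 : ℕ) : ℕ∞) ≤ M.eRank) (hcol : M.eRank = ((q + 2 : ℕ) : ℕ∞) → ∀ e, ¬ M.IsColoop e) :
    RLS M (q + 2) q :=
  rls_succ_succ_of_perFlatBelow q hq (perFlatBelow_of_residueBelow hres) M hs hge hcol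

end PercRepro.GenQ
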